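import Literature.Computability.AlgebraicComplexity.BurgisserBooleanParts
import Literature.Computability.AlgebraicComplexity.VNPClosedUnderComposition
import HarnessLib

/-!
# The Boolean-cube multilinearisation `ML_E g` of a polynomial in a block of variables

Workshop `decomp-valiant`, lens 6 «restricted-models lifting axis», generation 20 — the object behind
Criterion 2 of `Theorems/ClosureCollapseCriteria.lean` (the costume detector C19-1). Nothing here is
about the summit; rung currency: LADDER-Valiant rung 0.

For `g ∈ k[τ ⊕ Fin u]` (ambient variables `X_i`, `i ∈ τ`; a BLOCK `E_j`, `j < u`) over a commutative
ring `k`: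

* `cubeML g = Σ_{b ∈ {0,1}^u} g(X, b) · δ_b(E)` with `δ_b(E) = Π_j lit_{b_j}(E_j)` (`cubeSel`; `litPoly`
  of `BurgisserBooleanParts`) — the polynomial MULTILINEAR in the block agreeing with `g` at every
  Boolean point of the block: `aeval_cubeML_bool` (interpolation), `degreeOf_inr_cubeML_le_one`
  (multilinearity), `boolSum_cubeML` (same Boolean sum as `g`);
* the HALF-POINT IDENTITY `Σ_{e ∈ {0,1}^u} g(X, e) = 2^u · (cubeML g)(X, t, …, t)` for `2t = 1`
  (`aeval_cubeML_half`, `boolSum_eq_C_mul_aeval_cubeML`): Valiant's Boolean sum of `g` is ONE scaled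
  evaluation of its multilinearisation;
* the explicit `VP` witness `W(X, E, B) = g(X, B) · Π_j EQ(E_j, B_j)` over a fresh Boolean block `B`
  with `Σ_{b ∈ {0,1}^u} W(X, E, b) = cubeML g` (`cubeMLWitness`, `boolSum_cubeMLWitness`; `eqPoly` of
  `BurgisserBooleanParts`), whence for families: `g ∈ VP ⟹ (cubeML g_n)_n ∈ VNP` over EVERY
  commutative ring (`isVPFamily_cubeMLWitness`: `L ≤ L(g_n) + 8u(n)`, `deg ≤ deg g_n + 2u(n)`;
  `isVNPFamily_cubeML`).

Sources: the cube (multilinear) extension `Σ_b g(b) δ_b` is the standard arithmetisation object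
(e.g. [AaronsonWigderson2008, §4]); `VNP` via Boolean sums is Valiant's definition as typed in
`ValiantClasses` ([Valiant1979], [Burgisser2000, Ch. 2]); `litPoly`/`eqPoly` and their size bounds are
the tree's (`BurgisserBooleanParts`).
-/

noncomputable section

open MvPolynomial Literature.Computability.AlgebraicComplexity

set_option linter.dupNamespace false

namespace Summit.ValiantsHypothesis.ValiantsHypothesis.Theorems.CubeMultilinearisation

universe u v

/-! ## §1. `cubeML` and its substitution lemmas -/

section CubeML

variable {k : Type u} [CommRing k] {τ : Type v} {u : ℕ}

/-- The substitution specialising the block `Fin u` at the Boolean point `b` and keeping the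
ambient variable set: `X_i ↦ X_i`, `E_j ↦ [b_j] ∈ {0, 1}`. -/
def specMap (b : Fin u → Bool) : τ ⊕ Fin u → MvPolynomial (τ ⊕ Fin u) k :=
  Sum.elim (fun i => X (Sum.inl i)) (fun j => if b j then 1 else 0)

/-- `cubeSpec b g = g(X, b)`, read in `k[τ ⊕ Fin u]`. -/
def cubeSpec (b : Fin u → Bool) (g : MvPolynomial (τ ⊕ Fin u) k) : MvPolynomial (τ ⊕ Fin u) k :=
  aeval (specMap b) g

/-- The cube selector `δ_b(E) = Π_j lit_{b_j}(E_j)` (`E_j` if `b_j = 1`, `1 - E_j` if `b_j = 0`;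
`litPoly` of `BurgisserBooleanParts`): the multilinear indicator of the vertex `b`
(`rename Sum.inr` of `Literature.Computability.Complexity.Multilinear.delta b`). -/
def cubeSel (b : Fin u → Bool) : MvPolynomial (τ ⊕ Fin u) k :=
  ∏ j : Fin u, litPoly (b j) (X (Sum.inr j))

/-- **The Boolean-cube multilinearisation** of `g ∈ k[τ ⊕ Fin u]` in the block `Fin u`:
`cubeML g = Σ_{b ∈ {0,1}^u} g(X, b) · δ_b(E)` — the polynomial multilinear in `E` that agrees with
`g` at every Boolean point of the block. -/
def cubeML (g : MvPolynomial (τ ⊕ Fin u) k) : MvPolynomial (τ ⊕ Fin u) k :=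
  ∑ b : Fin u → Bool, cubeSpec b g * cubeSel b

/-! ### Substitutions into `cubeSpec`, `cubeSel`, `cubeML` -/

variable {A : Type*} [CommRing A] [Algebra k A]

/-- A substitution `η` after the specialisation at `b`: `η(g(X, b)) = g(η X, b)`. -/
theorem aeval_cubeSpec (η : τ ⊕ Fin u → A) (b : Fin u → Bool) (g : MvPolynomial (τ ⊕ Fin u) k) :
    aeval η (cubeSpec b g) =
      aeval (Sum.elim (fun i => η (Sum.inl i)) (fun j => if b j then (1 : A) else 0)) g := by
  have hfun : (fun x => aeval η (specMap (k := k) (τ := τ) b x)) =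
      Sum.elim (fun i => η (Sum.inl i)) (fun j => if b j then (1 : A) else 0) := by
    funext x
    rcases x with i | j
    · simp [specMap]
    · simp only [specMap, Sum.elim_inr]
      split_ifs <;> simp
  unfold cubeSpec
  rw [comp_aeval_apply, hfun]

/-- At a substitution sending the block variables to Boolean values `[e_j]`, the selector `δ_b`
becomes `[b = e]`. -/
theorem aeval_cubeSel_bool (η : τ ⊕ Fin u → A) (e : Fin u → Bool)
    (hη : ∀ j, η (Sum.inr j) = if e j then 1 else 0) (b : Fin u → Bool) :
    aeval η (cubeSel (k := k) (τ := τ) b) = if b = e then 1 else 0 := by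
  unfold cubeSel
  rw [map_prod]
  have hfac : ∀ j, aeval η (litPoly (b j) (X (Sum.inr j) : MvPolynomial (τ ⊕ Fin u) k)) =
      if b j = e j then (1 : A) else 0 := by
    intro j
    cases hb : b j <;> cases he : e j <;> simp [litPoly, hη j, he]
  simp_rw [hfac]
  split_ifs with hbe
  · subst hbe
    simp
  · obtain ⟨j, hj⟩ : ∃ j, b j ≠ e j := by
      by_contra hcon
      push Not at hcon
      exact hbe (funext hcon)
    exact Finset.prod_eq_zero (Finset.mem_univ j) (if_neg hj)

/-- At a substitution sending every block variable to a constant `t` with `2t = 1`, every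
selector `δ_b` becomes `t ^ u` (as `1 - t = t`). -/
theorem aeval_cubeSel_half (η : τ ⊕ Fin u → A) (t : A) (ht : t * 2 = 1)
    (hη : ∀ j, η (Sum.inr j) = t) (b : Fin u → Bool) :
    aeval η (cubeSel (k := k) (τ := τ) b) = t ^ u := by
  unfold cubeSel
  rw [map_prod]
  have hfac : ∀ j, aeval η (litPoly (b j) (X (Sum.inr j) : MvPolynomial (τ ⊕ Fin u) k)) = t := by
    intro j
    cases hb : b j
    · simp only [litPoly, Bool.false_eq_true, if_false, map_sub, map_one, aeval_X, hη j]
      linear_combination -ht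
    · simp [litPoly, hη j]
  simp_rw [hfac]
  simp

/-- **Interpolation.** `cubeML g` agrees with `g` at the Boolean points of the block: for every
substitution `η` with Boolean block values `[e_j]`, `η(cubeML g) = η(g)`. -/
theorem aeval_cubeML_bool (η : τ ⊕ Fin u → A) (e : Fin u → Bool)
    (hη : ∀ j, η (Sum.inr j) = if e j then 1 else 0) (g : MvPolynomial (τ ⊕ Fin u) k) :
    aeval η (cubeML g) = aeval η g := by
  have hη' : Sum.elim (fun i => η (Sum.inl i)) (fun j => if e j then (1 : A) else 0) = η := by
    funext x
    rcases x with i | j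
    · rfl
    · simp [hη j]
  unfold cubeML
  rw [map_sum]
  simp_rw [map_mul, aeval_cubeSel_bool η e hη]
  simp only [mul_ite, mul_one, mul_zero, Finset.sum_ite_eq', Finset.mem_univ, if_true]
  rw [aeval_cubeSpec, hη']

/-- **The half-point identity.** Substituting a constant `t` with `2t = 1` for every block
variable turns `cubeML g` into `t^u · Σ_{e ∈ {0,1}^u} g(η X, e)`: the Boolean sum is ONE
evaluation of the multilinearisation. -/
theorem aeval_cubeML_half (η : τ ⊕ Fin u → A) (t : A) (ht : t * 2 = 1)
    (hη : ∀ j, η (Sum.inr j) = t) (g : MvPolynomial (τ ⊕ Fin u) k) :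
    aeval η (cubeML g) =
      t ^ u * ∑ e : Fin u → Bool,
        aeval (Sum.elim (fun i => η (Sum.inl i)) (fun j => if e j then (1 : A) else 0)) g := by
  unfold cubeML
  rw [map_sum, Finset.mul_sum]
  refine Finset.sum_congr rfl fun b _ => ?_
  rw [map_mul, aeval_cubeSel_half η t ht hη, aeval_cubeSpec, mul_comm]

/-- The Boolean sum of the multilinearisation is the Boolean sum: `Σ_e (cubeML g)(X, e) = Σ_e g(X, e)`. -/
theorem boolSum_cubeML (g : MvPolynomial (τ ⊕ Fin u) k) : boolSum (cubeML g) = boolSum g := by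
  unfold boolSum
  refine Finset.sum_congr rfl fun e _ => ?_
  exact aeval_cubeML_bool _ e (fun j => rfl) g

/-- **Boolean sum = scaled half-point evaluation of the multilinearisation**:
`Σ_{e ∈ {0,1}^u} g(X, e) = 2^u · (cubeML g)(X, t, …, t)` whenever `2t = 1` in `k`. -/
theorem boolSum_eq_C_mul_aeval_cubeML (t : k) (ht : t * 2 = 1) (g : MvPolynomial (τ ⊕ Fin u) k) :
    boolSum g = C ((2 : k) ^ u) * aeval (Sum.elim X (fun _ : Fin u => C t)) (cubeML g) := by
  have hCt : (C t : MvPolynomial τ k) * 2 = 1 := by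
    rw [mul_two, ← C_add, ← mul_two, ht, C_1]
  rw [aeval_cubeML_half (Sum.elim X (fun _ : Fin u => C t)) (C t) hCt (fun j => rfl) g, ← mul_assoc,
    ← C_pow, ← C_mul, ← mul_pow, mul_comm (2 : k) t, ht, one_pow, C_1, one_mul]
  rfl

/-! ### Multilinearity of `cubeML` in the block -/

/-- The specialisation `g(X, b)` does not involve the block variables. -/
theorem degreeOf_inr_cubeSpec (b : Fin u → Bool) (g : MvPolynomial (τ ⊕ Fin u) k) (j : Fin u) :
    degreeOf (Sum.inr j) (cubeSpec b g) = 0 := by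
  classical
  unfold cubeSpec
  refine Nat.eq_zero_of_le_zero ?_
  induction g using MvPolynomial.induction_on with
  | C a => rw [aeval_C, algebraMap_eq, degreeOf_C]
  | add p q hp hq => rw [map_add]; exact (degreeOf_add_le _ _ _).trans (max_le hp hq)
  | mul_X p x hp =>
    rw [map_mul, aeval_X]
    refine (degreeOf_mul_le _ _ _).trans ?_
    have hx : degreeOf (Sum.inr j) (specMap (k := k) (τ := τ) b x) = 0 := by
      rcases x with i | j'
      · simp only [specMap, Sum.elim_inl]
        exact degreeOf_X_of_ne (by simp)
      · simp only [specMap, Sum.elim_inr]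
        split_ifs
        · exact degreeOf_one _
        · exact degreeOf_zero _
    rw [hx, add_zero]
    exact hp

/-- Each selector `δ_b` has degree `≤ 1` in every block variable. -/
theorem degreeOf_inr_cubeSel_le (b : Fin u → Bool) (j : Fin u) :
    degreeOf (Sum.inr j) (cubeSel (k := k) (τ := τ) b) ≤ 1 := by
  classical
  rcases subsingleton_or_nontrivial k with hk | hk
  · rw [Subsingleton.elim (cubeSel (k := k) (τ := τ) b) 0, degreeOf_zero]
    exact Nat.zero_le _
  unfold cubeSel
  refine (degreeOf_prod_le _ _ _).trans ?_
  have hfac : ∀ j', degreeOf (Sum.inr j) (litPoly (b j') (X (Sum.inr j') : MvPolynomial (τ ⊕ Fin u) k))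
      ≤ if j' = j then 1 else 0 := by
    intro j'
    have hX : degreeOf (Sum.inr j) (X (Sum.inr j') : MvPolynomial (τ ⊕ Fin u) k) =
        if j' = j then 1 else 0 := by
      rw [degreeOf_X]
      simp [eq_comm]
    cases b j'
    · simp only [litPoly, Bool.false_eq_true, if_false]
      refine (degreeOf_sub_le _ _ _).trans ?_
      rw [degreeOf_one, hX]
      simp
    · simp only [litPoly, if_true]
      rw [hX]
  refine (Finset.sum_le_sum fun j' _ => hfac j').trans ?_
  simp

/-- **`cubeML g` is multilinear in the block**: degree `≤ 1` in every block variable `E_j`. -/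
theorem degreeOf_inr_cubeML_le_one (g : MvPolynomial (τ ⊕ Fin u) k) (j : Fin u) :
    degreeOf (Sum.inr j) (cubeML g) ≤ 1 := by
  classical
  unfold cubeML
  refine (degreeOf_sum_le _ _ _).trans (Finset.sup_le fun b _ => ?_)
  refine (degreeOf_mul_le _ _ _).trans ?_
  rw [degreeOf_inr_cubeSpec, zero_add]
  exact degreeOf_inr_cubeSel_le b j

/-! ### The `VNP` witness of the multilinearisation -/

/-- The `VP`-witness exhibiting `cubeML g` as ONE Boolean sum over a fresh block `B` of `u`
Boolean variables: `W(X, E, B) = g(X, B) · Π_j EQ(E_j, B_j)` with `EQ(e, b) = eb + (1-e)(1-b)`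
(`eqPoly` of `BurgisserBooleanParts`), so that `Σ_{b ∈ {0,1}^u} W(X, E, b) = cubeML g`. -/
def cubeMLWitness (g : MvPolynomial (τ ⊕ Fin u) k) : MvPolynomial ((τ ⊕ Fin u) ⊕ Fin u) k :=
  aeval (Sum.elim (fun i => X (Sum.inl (Sum.inl i))) (fun j => X (Sum.inr j))) g *
    ∏ j : Fin u, eqPoly (X (Sum.inl (Sum.inr j))) (X (Sum.inr j))

/-- `EQ(w, [c]) = lit_c(w)`: the equality polynomial against a Boolean value is the literal. -/
theorem eqPoly_boolean {R : Type*} [CommRing R] {σ : Type*} (w : MvPolynomial σ R) (c : Bool) :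
    eqPoly w (if c then 1 else 0) = litPoly c w := by
  cases c <;> simp [eqPoly, litPoly]

/-- The Boolean sum of the witness is the multilinearisation. -/
theorem boolSum_cubeMLWitness (g : MvPolynomial (τ ⊕ Fin u) k) :
    boolSum (cubeMLWitness g) = cubeML g := by
  unfold boolSum cubeMLWitness cubeML
  refine Finset.sum_congr rfl fun e _ => ?_
  set φ : (τ ⊕ Fin u) ⊕ Fin u → MvPolynomial (τ ⊕ Fin u) k :=
    Sum.elim X (fun j => if e j then (1 : MvPolynomial (τ ⊕ Fin u) k) else 0) with hφ
  have hfun : (fun x => aeval φ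
      (Sum.elim (fun i => X (Sum.inl (Sum.inl i))) (fun j => X (Sum.inr j)) x :
        MvPolynomial ((τ ⊕ Fin u) ⊕ Fin u) k)) = specMap (k := k) (τ := τ) e := by
    funext x
    rcases x with i | j
    · simp [hφ, specMap]
    · simp [hφ, specMap]
  rw [map_mul, map_prod, comp_aeval_apply, hfun]
  unfold cubeSpec cubeSel
  congr 1
  refine Finset.prod_congr rfl fun j _ => ?_
  have h1 : aeval φ (X (Sum.inl (Sum.inr j)) : MvPolynomial ((τ ⊕ Fin u) ⊕ Fin u) k) =
      X (Sum.inr j) := by simp [hφ]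
  have h2 : aeval φ (X (Sum.inr j) : MvPolynomial ((τ ⊕ Fin u) ⊕ Fin u) k) =
      if e j then 1 else 0 := by simp [hφ]
  simp only [eqPoly, map_add, map_mul, map_sub, map_one, h1, h2]
  exact eqPoly_boolean (X (Sum.inr j)) (e j)

end CubeML

/-! ## §2. Families: `g ∈ VP ⟹ cubeML g ∈ VNP` -/

section CubeMLFamilies

variable {k : Type u} [CommRing k]

/-- The witness family of a `VP` family is `VP`: `L(W_n) ≤ L(g_n) + 8 u(n)`, `deg W_n ≤ deg g_n + 2u(n)`,
`v(n) + 2u(n)` variables. -/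
theorem isVPFamily_cubeMLWitness {v u : ℕ → ℕ} {g : ∀ n, MvPolynomial (Fin (v n) ⊕ Fin (u n)) k}
    (hg : IsVPFamily g) : IsVPFamily fun n => cubeMLWitness (g n) := by
  have hvu : IsPBounded fun n => v n + u n := hg.1.1.mono fun n => by simp [Fintype.card_sum]
  have hu : IsPBounded u := hvu.mono fun n => Nat.le_add_left _ _
  have hcard : IsPBounded fun n => Fintype.card ((Fin (v n) ⊕ Fin (u n)) ⊕ Fin (u n)) :=
    (IsPBounded.add_holds hvu hu).mono fun n => by simp [Fintype.card_sum]
  have h1 : IsVPFamily fun n => aeval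
      (Sum.elim (fun i => X (Sum.inl (Sum.inl i))) (fun j => X (Sum.inr j)) :
        (Fin (v n) ⊕ Fin (u n)) → MvPolynomial ((Fin (v n) ⊕ Fin (u n)) ⊕ Fin (u n)) k) (g n) := by
    refine IsVPFamily.aeval hg _ hcard ((IsPBounded.const 1).mono fun n => ?_)
      ((IsPBounded.const 0).mono fun n => le_of_eq ?_)
    · refine Finset.sup_le fun x _ => ?_
      rcases x with i | j <;> exact mvPolynomial_totalDegree_X_le_one _
    · refine Finset.sum_eq_zero fun x _ => ?_
      rcases x with i | j <;> exact complexity_X_holds _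
  have h2 : IsVPFamily fun n => ∏ j : Fin (u n),
      eqPoly (X (Sum.inl (Sum.inr j)) : MvPolynomial ((Fin (v n) ⊕ Fin (u n)) ⊕ Fin (u n)) k)
        (X (Sum.inr j)) := by
    refine ⟨⟨hcard, (IsPBounded.mul_holds (IsPBounded.const 2) hu).mono fun n => ?_⟩,
      (IsPBounded.mul_holds (IsPBounded.const 8) hu).mono fun n => ?_⟩
    · refine (totalDegree_finsetProd _ _).trans ?_
      refine (Finset.sum_le_sum fun j _ => (totalDegree_eqPoly_le _ _).trans
        (add_le_add (mvPolynomial_totalDegree_X_le_one _) (mvPolynomial_totalDegree_X_le_one _))).trans ?_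
      simp [mul_comm]
    · refine (complexity_finset_prod_le _ _).trans ?_
      have h7 : ∀ j : Fin (u n), complexity (eqPoly (X (Sum.inl (Sum.inr j)) :
          MvPolynomial ((Fin (v n) ⊕ Fin (u n)) ⊕ Fin (u n)) k) (X (Sum.inr j))) ≤ 7 := fun j =>
        (complexity_eqPoly_le _ _).trans (by rw [complexity_X_holds, complexity_X_holds])
      calc ∑ j, complexity (eqPoly (X (Sum.inl (Sum.inr j)) :
              MvPolynomial ((Fin (v n) ⊕ Fin (u n)) ⊕ Fin (u n)) k) (X (Sum.inr j))) +
              (Finset.univ : Finset (Fin (u n))).card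
          ≤ ∑ _j : Fin (u n), 7 + (Finset.univ : Finset (Fin (u n))).card := by
            gcongr with j
            exact h7 j
        _ = 8 * u n := by
            simp only [Finset.sum_const, smul_eq_mul, Finset.card_univ, Fintype.card_fin]
            ring
  exact h1.mul h2

/-- **Cube multilinearisations of `VP` families are in `VNP`** (over every commutative ring):
`cubeML g_n = Σ_{b ∈ {0,1}^{u(n)}} W_n(X, E, b)` with the `VP` witness `cubeMLWitness`. -/
theorem isVNPFamily_cubeML {v u : ℕ → ℕ} {g : ∀ n, MvPolynomial (Fin (v n) ⊕ Fin (u n)) k}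
    (hg : IsVPFamily g) : IsVNPFamily fun n => cubeML (g n) := by
  have hW := isVPFamily_cubeMLWitness hg
  refine ⟨⟨hg.1.1, hW.1.2.mono fun n => ?_⟩, u, fun n => cubeMLWitness (g n), hW,
    fun n => (boolSum_cubeMLWitness (g n)).symm⟩
  show (cubeML (g n)).totalDegree ≤ (cubeMLWitness (g n)).totalDegree
  rw [← boolSum_cubeMLWitness]
  exact totalDegree_boolSum_le _

end CubeMLFamilies

end Summit.ValiantsHypothesis.ValiantsHypothesis.Theorems.CubeMultilinearisation
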